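import Mathlib
import Literature.Computability.AlgebraicComplexity.JointCircuits
import Literature.Computability.AlgebraicComplexity.FFTCircuitCost
import Literature.Computability.AlgebraicComplexity.PolynomialDivisionCircuit
import HarnessLib

/-!
# Fast multipoint evaluation as a circuit: the remainder tree

Topic `Computability/AlgebraicComplexity`, namespace `Literature.Computability.AlgebraicComplexity`.
Everything PROVED; one bookkeeping definition (`remTreeCost`, a gate count), no named facts.

Von zur Gathen–Gerhard §10.1 (Algorithm 10.5 "going down the subproduct tree", Cor. 10.8):
the values `A(σ_1), …, A(σ_{2^K})` of a polynomial `A` of degree `< 2^K` over the ring of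
circuit NODES `k[X_τ]` at CONSTANT points `σ_r ∈ k` are the leaves of the remainder tree
`A mod ∏_{r ∈ I}(X − σ_r)`; each step down is one fast division by a constant monic polynomial
(`jointlyComputed_modByMonic`, `PolynomialDivisionCircuit.lean`).  In Bürgisser's model (constants
free, one gate per weighted addition or product of nodes):

* `remTreeCost K = (6K² + 15K) 2^K` (`remTreeCost_eq`);
* `jointlyComputed_remTree` — if the `2^K` coefficients of `A` are read off a jointly computed
  family within `s` gates then so are the `2^K` values `A(σ_r)` within `s + remTreeCost K`;
* `jointlyComputed_multipoint` — the same for any `M ≤ 2^K` points;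
* two pieces of generic plumbing used with it: `jointlyComputed_lincomb` (a `T × M` constant
  matrix applied to `M` members: `M·T` gates) and `jointlyComputed_fprod` (the product of `M + 1`
  members: `M` gates).

## References

* J. von zur Gathen, J. Gerhard, *Modern Computer Algebra*, CUP (3rd ed. 2013), §10.1
  (Algorithm 10.5, Cor. 10.8: fast multipoint evaluation in `O(M(n) log n)`). [GathenGerhard2013]
* [Burgisser2000] P. Bürgisser, *Completeness and Reduction in Algebraic Complexity Theory*,
  Springer 2000, Def. 2.1 (the circuit model).
-/

noncomputable section

open MvPolynomial

namespace Literature.Computability.AlgebraicComplexity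

section Multipoint

universe uu vv ww

variable {k : Type uu} [CommRing k] {τ : Type vv}

open _root_.Finset _root_.Polynomial

/-! ### The remainder tree -/

/-- Gate count of the remainder tree of depth `K`: two fast divisions at size `2^{K-1}` and two
subtrees. [cite: GathenGerhard2013, §10.1 Cor. 10.8] -/
def remTreeCost : ℕ → ℕ
  | 0 => 0
  | K + 1 => 2 * (modStepCost K + remTreeCost K)

/-- `remTreeCost K = (6K² + 15K) 2^K`. [cite: GathenGerhard2013, §10.1 Cor. 10.8] -/
theorem remTreeCost_eq (K : ℕ) : remTreeCost K = (6 * K ^ 2 + 15 * K) * 2 ^ K := by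
  induction K with
  | zero => simp [remTreeCost]
  | succ K ih => rw [remTreeCost, ih, modStepCost_eq, pow_succ]; ring

/-- The remainder modulo a node polynomial keeps the values at its roots:
`(A %ₘ P)(a) = A(a)` when `P(a) = 0` (`P = p.map C` constant monic). [cite: GathenGerhard2013, §10.1 Algorithm 10.5] -/
theorem eval_modByMonic_map_of_root (p : k[X]) (A : (MvPolynomial τ k)[X]) (a : k)
    (ha : p.eval a = 0) :
    (A %ₘ p.map MvPolynomial.C).eval (MvPolynomial.C a) = A.eval (MvPolynomial.C a) := by
  have h := congrArg (Polynomial.eval (MvPolynomial.C a : MvPolynomial τ k))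
    (modByMonic_add_div A (p.map MvPolynomial.C))
  rw [Polynomial.eval_add, Polynomial.eval_mul, Polynomial.eval_map, Polynomial.eval₂_hom, ha,
    MvPolynomial.C_0, zero_mul, add_zero] at h
  exact h

/-- The node polynomial `∏_{r} (X − σ_r)` of a block of points: monic, of degree the block size,
vanishing at each point. [cite: GathenGerhard2013, §10.1 Lemma 10.4] -/
theorem nodePoly_monic {m : ℕ} (σ : Fin m → k) :
    (∏ r : Fin m, (Polynomial.X - Polynomial.C (σ r))).Monic :=
  monic_prod_of_monic _ _ fun r _ => monic_X_sub_C (σ r)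

/-- Degree of the node polynomial. [cite: GathenGerhard2013, §10.1 Lemma 10.4] -/
theorem nodePoly_natDegree [Nontrivial k] {m : ℕ} (σ : Fin m → k) :
    (∏ r : Fin m, (Polynomial.X - Polynomial.C (σ r))).natDegree = m := by
  rw [natDegree_prod_of_monic _ _ fun r _ => monic_X_sub_C (σ r)]
  simp

/-- The node polynomial vanishes at its points. [cite: GathenGerhard2013, §10.1 Lemma 10.4] -/
theorem nodePoly_eval {m : ℕ} (σ : Fin m → k) (r : Fin m) :
    (∏ r' : Fin m, (Polynomial.X - Polynomial.C (σ r'))).eval (σ r) = 0 := by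
  rw [Polynomial.eval_prod]
  exact prod_eq_zero (mem_univ r)
    (by rw [Polynomial.eval_sub, Polynomial.eval_X, Polynomial.eval_C, sub_self])

/-- **The remainder tree as a circuit** (GG Algorithm 10.5 / Cor. 10.8, cost part, in
Bürgisser's model): if the `2^K` coefficients of `A ∈ k[X_τ][X]` (`a_i = 0` for `i ≥ 2^K`) are read
off a jointly computed family within `s` gates, then so are the values `A(C σ_r)` at `2^K` constant
points within `s + remTreeCost K` gates (roots of unity `ζ κ` with `(ζ κ)^{2^{κ-1}} = −1` and
inverses `tinv κ` of `2^κ` for the fast divisions). [cite: GathenGerhard2013, §10.1 Cor. 10.8] -/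
theorem jointlyComputed_remTree [Nontrivial k] (ζ tinv : ℕ → k)
    (hζ : ∀ κ, κ ≠ 0 → ζ κ ^ 2 ^ (κ - 1) = -1) (ht : ∀ κ, (2 ^ κ : k) * tinv κ = 1) :
    ∀ (K : ℕ) {ι : Type ww} (v : ι → MvPolynomial τ k) (s : ℕ) (A : (MvPolynomial τ k)[X])
      (σ : Fin (2 ^ K) → k) (eA : Fin (2 ^ K) → ι),
      JointlyComputed v s → (∀ i, 2 ^ K ≤ i → A.coeff i = 0) → (∀ i, v (eA i) = A.coeff i) →
      JointlyComputed (Sum.elim v (fun r : Fin (2 ^ K) => A.eval (MvPolynomial.C (σ r))))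
        (s + remTreeCost K)
  | 0, ι, v, s, A, σ, eA, hv, hA, heA => by
    rw [remTreeCost, Nat.add_zero]
    have hAC : A = Polynomial.C (A.coeff 0) := by
      refine Polynomial.ext fun i => ?_
      rw [Polynomial.coeff_C]
      split_ifs with hi
      · rw [hi]
      · exact hA i (by rw [pow_zero]; omega)
    refine hv.of_mem _ ?_
    rintro (x | r)
    · exact Or.inl ⟨x, rfl⟩
    · refine Or.inl ⟨eA ⟨0, Nat.one_le_two_pow⟩, ?_⟩
      simp only [Sum.elim_inr]
      rw [hAC, Polynomial.eval_C, heA]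
  | K + 1, ι, v, s, A, σ, eA, hv, hA, heA => by
    have hlen : 2 ^ (K + 1) = 2 ^ K + 2 ^ K := by rw [pow_succ, mul_two]
    let lo : Fin (2 ^ K) → Fin (2 ^ (K + 1)) := fun r => ⟨r, by omega⟩
    let hi : Fin (2 ^ K) → Fin (2 ^ (K + 1)) := fun r => ⟨2 ^ K + r, by omega⟩
    have hK1 : K + 1 ≠ 0 := Nat.succ_ne_zero _
    -- remainders have small degree
    have hrem : ∀ (q : k[X]), q.Monic → q.natDegree = 2 ^ K →
        ∀ i, 2 ^ K ≤ i → (A %ₘ q.map MvPolynomial.C).coeff i = 0 := by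
      intro q hq hqd i hi2
      have hqm : (q.map (MvPolynomial.C : k →+* MvPolynomial τ k)).Monic := hq.map _
      refine coeff_eq_zero_of_degree_lt (lt_of_lt_of_le (degree_modByMonic_lt A hqm) ?_)
      rw [degree_eq_natDegree hqm.ne_zero, hq.natDegree_map, hqd]
      exact_mod_cast hi2
    -- the lower half
    have h1 := jointlyComputed_modByMonic hv K (hζ (K + 1) hK1) (ht (K + 1)) _
      (nodePoly_monic (σ ∘ lo)) (nodePoly_natDegree (σ ∘ lo)) A hA eA heA
    have h2 := jointlyComputed_remTree ζ tinv hζ ht K _ _ _ (σ ∘ lo) (fun i => Sum.inr i) h1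
      (hrem _ (nodePoly_monic _) (nodePoly_natDegree _)) (fun i => rfl)
    -- the upper half
    have h3 := jointlyComputed_modByMonic h2 K (hζ (K + 1) hK1) (ht (K + 1)) _
      (nodePoly_monic (σ ∘ hi)) (nodePoly_natDegree (σ ∘ hi)) A hA
      (fun i => Sum.inl (Sum.inl (eA i))) (fun i => by simp [heA])
    have h4 := jointlyComputed_remTree ζ tinv hζ ht K _ _ _ (σ ∘ hi) (fun i => Sum.inr i) h3
      (hrem _ (nodePoly_monic _) (nodePoly_natDegree _)) (fun i => rfl)
    have hcost : s + modStepCost K + remTreeCost K + modStepCost K + remTreeCost K =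
        s + remTreeCost (K + 1) := by rw [remTreeCost]; ring
    rw [hcost] at h4
    refine h4.of_mem _ ?_
    rintro (x | r)
    · exact Or.inl ⟨Sum.inl (Sum.inl (Sum.inl (Sum.inl x))), rfl⟩
    · by_cases hr : (r : ℕ) < 2 ^ K
      · refine Or.inl ⟨Sum.inl (Sum.inl (Sum.inr ⟨r, hr⟩)), ?_⟩
        have hr' : lo ⟨r, hr⟩ = r := Fin.ext rfl
        have h := eval_modByMonic_map_of_root _ A _ (nodePoly_eval (σ ∘ lo) ⟨r, hr⟩)
        simp only [Sum.elim_inr, Sum.elim_inl, Function.comp] at h ⊢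
        rw [hr'] at h ⊢
        exact h.symm
      · have hr2 : (r : ℕ) - 2 ^ K < 2 ^ K := by have := r.isLt; omega
        refine Or.inl ⟨Sum.inr ⟨r - 2 ^ K, hr2⟩, ?_⟩
        have hr' : hi ⟨r - 2 ^ K, hr2⟩ = r := Fin.ext (by simp [hi]; omega)
        have h := eval_modByMonic_map_of_root _ A _ (nodePoly_eval (σ ∘ hi) ⟨r - 2 ^ K, hr2⟩)
        simp only [Sum.elim_inr, Function.comp] at h ⊢
        rw [hr'] at h ⊢
        exact h.symm

/-- **Fast multipoint evaluation as a circuit**: the values of `A` (degree `< 2^K`, coefficients in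
the family) at any `M ≤ 2^K` constant points, within `remTreeCost K = (6K² + 15K)2^K` further
gates. [cite: GathenGerhard2013, §10.1 Cor. 10.8] -/
theorem jointlyComputed_multipoint [Nontrivial k] (ζ tinv : ℕ → k)
    (hζ : ∀ κ, κ ≠ 0 → ζ κ ^ 2 ^ (κ - 1) = -1) (ht : ∀ κ, (2 ^ κ : k) * tinv κ = 1)
    {ι : Type ww} {v : ι → MvPolynomial τ k} {s : ℕ} (hv : JointlyComputed v s)
    (K : ℕ) (A : (MvPolynomial τ k)[X]) (hA : ∀ i, 2 ^ K ≤ i → A.coeff i = 0)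
    (eA : Fin (2 ^ K) → ι) (heA : ∀ i, v (eA i) = A.coeff i)
    {M : ℕ} (hM : M ≤ 2 ^ K) (σ : Fin M → k) :
    JointlyComputed (Sum.elim v (fun r : Fin M => A.eval (MvPolynomial.C (σ r))))
      (s + remTreeCost K) := by
  let σ' : Fin (2 ^ K) → k := fun r => if h : (r : ℕ) < M then σ ⟨r, h⟩ else 0
  have h := jointlyComputed_remTree ζ tinv hζ ht K v s A σ' eA hv hA heA
  refine h.of_mem _ ?_
  rintro (x | r)
  · exact Or.inl ⟨Sum.inl x, rfl⟩
  · refine Or.inl ⟨Sum.inr ⟨r, by omega⟩, ?_⟩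
    simp [σ', r.isLt]

/-! ### Plumbing: constant linear combinations and products of members -/

/-- **A constant matrix applied to members**: the `T` combinations `Σ_{l<m} a_{j,l} · y_l`
(`j < T`) of members `y_0, …, y_{M-1}` are jointly computed within `m · T` further gates (partial
sums over `l < m`, all `j` in parallel). [cite: Burgisser2000, Def. 2.1] -/
theorem jointlyComputed_lincomb {ι : Type ww} {v : ι → MvPolynomial τ k} {s : ℕ}
    (hv : JointlyComputed v s) {M T : ℕ} (a : Fin T → Fin M → k) (ey : Fin M → ι) :
    ∀ m : ℕ, m ≤ M → JointlyComputed (Sum.elim v (fun j : Fin T =>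
      ∑ l ∈ (univ : Finset (Fin M)).filter (fun l : Fin M => l.val < m), a j l • v (ey l)))
        (s + m * T)
  | 0, _ => by
    rw [Nat.zero_mul, Nat.add_zero]
    refine hv.of_mem _ ?_
    rintro (x | j)
    · exact Or.inl ⟨x, rfl⟩
    · refine Or.inr (Or.inr ⟨0, ?_⟩)
      simp
  | m + 1, hm => by
    have ih := jointlyComputed_lincomb hv a ey m (by omega)
    have h1 := ih.extend_wadd (κ := Fin T) (fun _ => (1 : k)) (fun j => a j ⟨m, hm⟩)
      (fun j => Sum.inr j) (fun _ => Sum.inl (ey ⟨m, hm⟩))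
    rw [Fintype.card_fin, show s + m * T + T = s + (m + 1) * T by ring] at h1
    refine h1.of_mem _ ?_
    rintro (x | j)
    · exact Or.inl ⟨Sum.inl (Sum.inl x), rfl⟩
    · refine Or.inl ⟨Sum.inr j, ?_⟩
      simp only [Sum.elim_inr, Sum.elim_inl, one_smul]
      have hsplit : (univ : Finset (Fin M)).filter (fun l : Fin M => l.val < m + 1) =
          insert ⟨m, hm⟩ ((univ : Finset (Fin M)).filter (fun l : Fin M => l.val < m)) := by
        ext l
        simp only [mem_filter, mem_univ, true_and, mem_insert, Fin.ext_iff]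
        omega
      have hnot : (⟨m, hm⟩ : Fin M) ∉ (univ : Finset (Fin M)).filter (fun l : Fin M => l.val < m) := by
        simp
      rw [hsplit, sum_insert hnot, add_comm]

/-- All `M` terms: `Σ_{l<M} a_{j,l} · y_l` for `j < T` within `M · T` gates.
[cite: Burgisser2000, Def. 2.1] -/
theorem jointlyComputed_lincomb_all {ι : Type ww} {v : ι → MvPolynomial τ k} {s : ℕ}
    (hv : JointlyComputed v s) {M T : ℕ} (a : Fin T → Fin M → k) (ey : Fin M → ι) :
    JointlyComputed (Sum.elim v (fun j : Fin T => ∑ l : Fin M, a j l • v (ey l))) (s + M * T) := by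
  have h := jointlyComputed_lincomb hv a ey M le_rfl
  refine h.of_mem _ ?_
  rintro (x | j)
  · exact Or.inl ⟨Sum.inl x, rfl⟩
  · refine Or.inl ⟨Sum.inr j, ?_⟩
    simp only [Sum.elim_inr]
    rw [filter_true_of_mem (fun l _ => l.isLt)]

/-- **Products of members**: `∏_{l ≤ m} y_l` within `m` further gates.
[cite: Burgisser2000, Def. 2.1] -/
theorem jointlyComputed_fprod {ι : Type ww} {v : ι → MvPolynomial τ k} {s : ℕ}
    (hv : JointlyComputed v s) (y : ℕ → MvPolynomial τ k) :
    ∀ (m : ℕ) (ey : Fin (m + 1) → ι), (∀ l, v (ey l) = y l) →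
      JointlyComputed (Sum.elim v (fun _ : Unit => ∏ l ∈ range (m + 1), y l)) (s + m)
  | 0, ey, hey => by
    rw [Nat.add_zero]
    refine hv.of_mem _ ?_
    rintro (x | u)
    · exact Or.inl ⟨x, rfl⟩
    · exact Or.inl ⟨ey 0, by simp [hey]⟩
  | m + 1, ey, hey => by
    have ih := jointlyComputed_fprod hv y m (fun l => ey (Fin.castSucc l)) (fun l => by
      rw [hey]; rfl)
    have h1 := ih.extend_mul (κ := Unit) (fun _ => Sum.inr ()) (fun _ => Sum.inl (ey (Fin.last (m + 1))))
    rw [Fintype.card_unit, show s + m + 1 = s + (m + 1) by ring] at h1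
    refine h1.of_mem _ ?_
    rintro (x | u)
    · exact Or.inl ⟨Sum.inl (Sum.inl x), rfl⟩
    · refine Or.inl ⟨Sum.inr (), ?_⟩
      simp only [Sum.elim_inr, Sum.elim_inl, hey]
      rw [prod_range_succ]
      rfl

end Multipoint

end Literature.Computability.AlgebraicComplexity

end
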